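import Summits.RiemannHypothesis.RiemannHypothesis.Theorems.SoloInformedBoxWeil
import Literature.NumberTheory.LFunctions.WeilWindowSuzukiProofs
import Literature.NumberTheory.LFunctions.WeilExplicitApproxIdentity
import Literature.NumberTheory.LFunctions.WeilSquareMollifier
import Literature.NumberTheory.LFunctions.WeilArchimedeanPositivityProofs
import Literature.NumberTheory.LFunctions.WeilMellinBounds

/-!
# The screw function bounds the window ground energy: `ε(a) ≤ Ψ(2a)/a` (solo-informed, T51)

`ε(a) = weilGroundEnergy a` is the infimum of the Rayleigh quotient `Re Q(g)/‖g‖₂²` of Weil's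
quadratic functional over SMOOTH tests supported in `[-a, a]` (Bombieri 2000 §4, Yoshida 1992;
`= λ_a`, the bottom of the spectrum of Suzuki's operator `A_a`, arXiv:2606.09096 Cor. 1.2).  By
`SoloInformedBoxWeil` the Rayleigh quotient at the (non-smooth) box `𝟙_{(-b,b)}` is `Ψ(2b)/b`.  Here we
put the box into the form domain: mollifying it by the tree's bumps `φ_m` (`WeilContinuous.moll`) gives
smooth window tests `𝟙_b ⋆ φ_m` whose autocorrelations are, by associativity and commutativity of
convolution (`weilConv_assoc`, `weilConv_comm`, `weilReflect_weilConv` — Mathlib's `convolution_assoc`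
/ `convolution_flip` transported to `weilConv`),

  `(𝟙_b ⋆ φ_m) ⋆ (𝟙_b ⋆ φ_m)~ = (𝟙_b ⋆ 𝟙̃_b) ⋆ (φ_m ⋆ φ̃_m) = 2Δ_{2b} ⋆ ν_m`   (`weilConv_smoothBox_weilReflect`),

the twice-tent smoothed by the square mollifiers `ν_m` of `WeilSquareMollifier`.  The tree's
approximate-identity theorem `WeilApproxIdentity.tendsto_weilFunctional` (with the integrability
`integrable_weilMellin_tent_digamma` of `SoloInformedTentExplicit`) then gives
`Q(𝟙_b ⋆ φ_m) → W(2Δ_{2b}) = 2Ψ(2b)` and `‖𝟙_b ⋆ φ_m‖₂² → 2b`, whence (`weilGroundEnergy_le_div`)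

  `ε(a) ≤ Ψ(2b)/b` for `0 < b < a`, and by continuity of `Ψ`,  **`ε(a) ≤ Ψ(2a)/a`**
  (`weilGroundEnergy_le_zetaScrew_div`).

Consequences: a negative screw value `Ψ(t) < 0` forces `ε(t/2) < 0`, i.e. Weil positivity already
fails on the window `[-t/2, t/2]` (`not_weilPositivityOn_of_zetaScrew_neg`); equivalently Weil
positivity on `[-a, a]` implies `Ψ ≥ 0` on `[0, 2a]` (`zetaScrew_nonneg_of_weilPositivityOn`).

References: E. Bombieri, Rend. Mat. Acc. Lincei (9) 11 (2000) §§3–4; M. Suzuki, arXiv:2209.12773,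
Thm. 1.7; M. Suzuki, arXiv:2606.09096, Thm. 1.1, Cor. 1.2.
-/

noncomputable section

open Complex Set MeasureTheory Filter Topology Literature.NumberTheory.LFunctions
open scoped ComplexConjugate

namespace Summit.RiemannHypothesis.RiemannHypothesis.Theorems

open WeilContinuous WeilSquareMollifier

/-! ## Convolution algebra for `weilConv` -/

/-- Commutativity of `weilConv` (no hypotheses; Mathlib `convolution_flip`). -/
theorem weilConv_comm (f g : ℝ → ℂ) : weilConv f g = weilConv g f := by
  have h := convolution_flip (L := ContinuousLinearMap.mul ℂ ℂ) (μ := (volume : Measure ℝ))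
    (f := f) (g := g)
  rw [ContinuousLinearMap.flip_mul] at h
  exact h.symm

/-- The involution is an anti-automorphism turned automorphism of the (commutative) convolution:
`(f ⋆ g)~ = f̃ ⋆ g̃` (no hypotheses). -/
theorem weilReflect_weilConv (f g : ℝ → ℂ) :
    weilReflect (weilConv f g) = weilConv (weilReflect f) (weilReflect g) := by
  funext x
  simp only [weilReflect, weilConv_apply, ← integral_conj, map_mul]
  rw [← integral_neg_eq_self (fun u ↦ (starRingEnd ℂ) (f u) * (starRingEnd ℂ) (g (-x - u))) volume]
  congr 1 with u
  rw [show -x - -u = -(x - u) by ring]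

/-- Associativity of `weilConv` for integrable `f`, integrable compactly supported `g` and continuous
compactly supported `k` (Mathlib `convolution_assoc`; the side conditions hold because
`‖g‖ ⋆ ‖k‖` is continuous of compact support). -/
theorem weilConv_assoc {f g k : ℝ → ℂ} (hf : Integrable f) (hg : Integrable g)
    (hg' : HasCompactSupport g) (hk : Continuous k) (hk' : HasCompactSupport k) :
    weilConv (weilConv f g) k = weilConv f (weilConv g k) := by
  funext x
  have hgk : ∀ y, ConvolutionExistsAt (fun x ↦ ‖g x‖) (fun x ↦ ‖k x‖) y
      (ContinuousLinearMap.mul ℝ ℝ) volume :=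
    hk'.norm.convolutionExists_right (ContinuousLinearMap.mul ℝ ℝ) hg.norm.locallyIntegrable hk.norm
  have hcont : Continuous (convolution (fun x ↦ ‖g x‖) (fun x ↦ ‖k x‖)
      (ContinuousLinearMap.mul ℝ ℝ) volume) :=
    hk'.norm.continuous_convolution_right (ContinuousLinearMap.mul ℝ ℝ) hg.norm.locallyIntegrable
      hk.norm
  have hcs : HasCompactSupport (convolution (fun x ↦ ‖g x‖) (fun x ↦ ‖k x‖)
      (ContinuousLinearMap.mul ℝ ℝ) volume) :=
    hg'.norm.convolution (ContinuousLinearMap.mul ℝ ℝ) hk'.norm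
  have hfgk := hcs.convolutionExists_right (ContinuousLinearMap.mul ℝ ℝ) hf.norm.locallyIntegrable
    hcont x
  exact convolution_assoc (ContinuousLinearMap.mul ℂ ℂ) (ContinuousLinearMap.mul ℂ ℂ)
    (ContinuousLinearMap.mul ℂ ℂ) (ContinuousLinearMap.mul ℂ ℂ) (fun a b c ↦ by simp [mul_assoc])
    hf.aestronglyMeasurable hg.aestronglyMeasurable hk.aestronglyMeasurable
    (hf.ae_convolution_exists (ContinuousLinearMap.mul ℂ ℂ) hg) (Eventually.of_forall hgk) hfgk

/-! ## The box and its mollifications -/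

/-- The box is integrable. -/
theorem integrable_boxTest (b : ℝ) : Integrable (boxTest b) := by
  unfold boxTest
  exact (integrable_indicator_iff measurableSet_Ioo).2
    ((continuousOn_const.integrableOn_compact isCompact_Icc).mono_set Ioo_subset_Icc_self)

/-- The box has compact support. -/
theorem hasCompactSupport_boxTest (b : ℝ) : HasCompactSupport (boxTest b) :=
  HasCompactSupport.intro isCompact_Icc fun _ hx ↦
    indicator_of_notMem (fun h ↦ hx (Ioo_subset_Icc_self h)) _

/-- `tsupport 𝟙_b ⊆ [-b, b]`. -/
theorem tsupport_boxTest_subset (b : ℝ) : tsupport (boxTest b) ⊆ Icc (-b) b :=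
  closure_minimal (support_indicator_subset.trans Ioo_subset_Icc_self) isClosed_Icc

/-- The box is self-adjoint: `𝟙̃_b = 𝟙_b` (real and even). -/
theorem weilReflect_boxTest (b : ℝ) : weilReflect (boxTest b) = boxTest b := by
  funext x
  simp only [weilReflect, boxTest_apply]
  by_cases h : -b < x ∧ x < b
  · have h' : -b < -x ∧ -x < b := ⟨by linarith [h.2], by linarith [h.1]⟩
    rw [if_pos h, if_pos h']; simp
  · have h' : ¬(-b < -x ∧ -x < b) := fun h2 ↦ h ⟨by linarith [h2.2], by linarith [h2.1]⟩
    rw [if_neg h, if_neg h']; simp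

/-- Twice the tent of width `2b`: `2Δ_{2b}(x) = (2b - |x|)₊`, the autocorrelation of the box. -/
def twoTent (b : ℝ) : ℝ → ℂ := fun x ↦ 2 * tent (2 * b) x

/-- `𝟙_b ⋆ 𝟙_b = 2Δ_{2b}`. -/
theorem weilConv_boxTest_boxTest (b : ℝ) : weilConv (boxTest b) (boxTest b) = twoTent b := by
  have h := weilConv_boxTest_weilReflect_eq b
  rwa [weilReflect_boxTest] at h

/-- `2Δ_{2b}` is continuous. -/
theorem continuous_twoTent (b : ℝ) : Continuous (twoTent b) :=
  continuous_const.mul (continuous_tent _)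

/-- `2Δ_{2b}` has compact support. -/
theorem hasCompactSupport_twoTent (b : ℝ) : HasCompactSupport (twoTent b) :=
  (hasCompactSupport_tent (2 * b)).mul_left

/-- `2Δ_{2b}(0) = 2b` (`b ≥ 0`). -/
theorem twoTent_zero {b : ℝ} (hb : 0 ≤ b) : twoTent b 0 = ((2 * b : ℝ) : ℂ) := by
  show (2 : ℂ) * tent (2 * b) 0 = _
  rw [tent_zero _ (by positivity : (0 : ℝ) ≤ 2 * b)]
  push_cast
  ring

/-- `(2Δ_{2b})^(s) = 2 Δ̂_{2b}(s)`. -/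
theorem weilMellin_twoTent (b : ℝ) (s : ℂ) :
    weilMellin (twoTent b) s = 2 * weilMellin (tent (2 * b)) s :=
  weilMellin_const_mul 2 (tent (2 * b)) s

/-- `W(2Δ_{2b}) = 2Ψ(2b)` (`b ≥ 0`; `SoloInformedTentArch.weilFunctional_tent_eq_zetaScrew`). -/
theorem weilFunctional_twoTent {b : ℝ} (hb : 0 ≤ b) :
    weilFunctional (twoTent b) = 2 * (zetaScrew (2 * b) : ℂ) := by
  show weilFunctional (fun x ↦ 2 * tent (2 * b) x) = _
  rw [weilFunctional_const_mul, weilFunctional_tent_eq_zetaScrew (by positivity)]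

/-- The archimedean integrand of `2Δ_{2b}` is integrable (`b ≥ 0`). -/
theorem integrable_weilMellin_twoTent_digamma {b : ℝ} (hb : 0 ≤ b) :
    Integrable fun t : ℝ ↦ weilMellin (twoTent b) (1 / 2 + t * I) *
      ((Complex.digamma (1 / 4 + t / 2 * I)).re : ℂ) := by
  have h := (integrable_weilMellin_tent_digamma (t := 2 * b) (by positivity)).const_mul 2
  refine h.congr (Eventually.of_forall fun t ↦ ?_)
  simp only [weilMellin_twoTent]
  ring

/-- The smoothed box `𝟙_b ⋆ φ_m` (`φ_m = WeilContinuous.moll m`, radius `1/(m+1)`). -/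
def smoothBox (b : ℝ) (m : ℕ) : ℝ → ℂ := weilConv (boxTest b) (moll m)

/-- The smoothed box is a Weil test (smooth by `HasCompactSupport.contDiff_convolution_right`). -/
theorem isWeilTest_smoothBox (b : ℝ) (m : ℕ) : IsWeilTest (smoothBox b m) := by
  unfold smoothBox
  rw [weilConv_eq_convolution_real]
  exact ⟨(hasCompactSupport_moll m).contDiff_convolution_right (ContinuousLinearMap.mul ℝ ℂ)
      (integrable_boxTest b).locallyIntegrable (contDiff_moll m),
    (hasCompactSupport_boxTest b).convolution (ContinuousLinearMap.mul ℝ ℂ) (hasCompactSupport_moll m)⟩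

/-- `tsupport (𝟙_b ⋆ φ_m) ⊆ [-(b + r_m), b + r_m]`. -/
theorem tsupport_smoothBox_subset (b : ℝ) (m : ℕ) :
    tsupport (smoothBox b m) ⊆ Icc (-(b + (bump m).rOut)) (b + (bump m).rOut) := by
  refine (tsupport_weilConv_subset (hasCompactSupport_boxTest b)).trans ?_
  rintro x ⟨u, hu, v, hv, rfl⟩
  have hu' := tsupport_boxTest_subset b hu
  have hv' := tsupport_moll_subset m hv
  simp only [mem_Icc] at hu' hv' ⊢
  constructor <;> linarith

/-- **The autocorrelation of the smoothed box is the smoothed twice-tent**: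
`(𝟙_b ⋆ φ_m) ⋆ (𝟙_b ⋆ φ_m)~ = 2Δ_{2b} ⋆ (φ_m ⋆ φ̃_m)`. -/
theorem weilConv_smoothBox_weilReflect (b : ℝ) (m : ℕ) :
    weilConv (smoothBox b m) (weilReflect (smoothBox b m)) =
      weilConv (twoTent b) (weilConv (moll m) (weilReflect (moll m))) := by
  have hh := integrable_boxTest b
  have hh' := hasCompactSupport_boxTest b
  have hφc := continuous_moll m
  have hφ' := hasCompactSupport_moll m
  have hφ : Integrable (moll m) := hφc.integrable_of_hasCompactSupport hφ'
  have hφr : IsWeilTest (weilReflect (moll m)) := (isWeilTest_moll m).weilReflect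
  have hφrc : Continuous (weilReflect (moll m)) := hφr.1.continuous
  have hφr' : HasCompactSupport (weilReflect (moll m)) := hφr.2
  have hk1c : Continuous (weilConv (boxTest b) (weilReflect (moll m))) :=
    hφr'.continuous_convolution_right (ContinuousLinearMap.mul ℂ ℂ) hh.locallyIntegrable hφrc
  have hk1' : HasCompactSupport (weilConv (boxTest b) (weilReflect (moll m))) :=
    hh'.convolution (ContinuousLinearMap.mul ℂ ℂ) hφr'
  have hνc : Continuous (weilConv (moll m) (weilReflect (moll m))) := continuous_sqMoll m
  have hν' : HasCompactSupport (weilConv (moll m) (weilReflect (moll m))) := (isWeilTest_sqMoll m).2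
  unfold smoothBox
  rw [weilReflect_weilConv, weilReflect_boxTest, weilConv_assoc hh hφ hφ' hk1c hk1',
    ← weilConv_assoc hφ hh hh' hφrc hφr', weilConv_comm (moll m) (boxTest b),
    weilConv_assoc hh hφ hφ' hφrc hφr', ← weilConv_assoc hh hh hh' hνc hν', weilConv_boxTest_boxTest]

/-- `Q(𝟙_b ⋆ φ_m) = W(2Δ_{2b} ⋆ ν_m)`. -/
theorem weilQuadratic_smoothBox (b : ℝ) (m : ℕ) :
    weilQuadratic (smoothBox b m) =
      weilFunctional (weilConv (twoTent b) (weilConv (moll m) (weilReflect (moll m)))) := by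
  rw [weilQuadratic, weilConv_smoothBox_weilReflect]

/-- `‖𝟙_b ⋆ φ_m‖₂² = (2Δ_{2b} ⋆ ν_m)(0)`. -/
theorem integral_norm_sq_smoothBox (b : ℝ) (m : ℕ) :
    ((∫ x : ℝ, ‖smoothBox b m x‖ ^ 2 : ℝ) : ℂ) =
      weilConv (twoTent b) (weilConv (moll m) (weilReflect (moll m))) 0 := by
  rw [← weilConv_smoothBox_weilReflect, weilConv_weilReflect_apply_zero]

/-! ## The limit along the square mollifiers -/

/-- `Q(𝟙_b ⋆ φ_{n+1}) → 2Ψ(2b)` (`b ≥ 0`). -/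
theorem tendsto_re_weilQuadratic_smoothBox {b : ℝ} (hb : 0 ≤ b) :
    Tendsto (fun n : ℕ ↦ (weilQuadratic (smoothBox b (n + 1))).re) atTop
      (𝓝 (2 * zetaScrew (2 * b))) := by
  have huc : ∀ n : ℕ, Continuous (weilConv (moll (n + 1)) (weilReflect (moll (n + 1)))) :=
    fun n ↦ continuous_sqMoll (n + 1)
  have hδ0 : Tendsto (fun n : ℕ ↦ 2 * (bump (n + 1)).rOut) atTop (𝓝 0) :=
    tendsto_two_mul_bump_rOut.comp (tendsto_add_atTop_nat 1)
  have hδ1 : ∀ n : ℕ, 2 * (bump (n + 1)).rOut ≤ 1 := fun n ↦ by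
    rw [two_mul_bump_rOut, div_le_one (by positivity)]
    push_cast
    linarith
  have hus : ∀ (n : ℕ) (x : ℝ), 2 * (bump (n + 1)).rOut ≤ |x| →
      weilConv (moll (n + 1)) (weilReflect (moll (n + 1))) x = 0 := fun n x hx ↦ sqMoll_eq_zero hx
  have hu1 : ∀ n : ℕ, ∫ x, weilConv (moll (n + 1)) (weilReflect (moll (n + 1))) x = 1 :=
    fun n ↦ integral_sqMoll (n + 1)
  have hun : ∀ n : ℕ, ∫ x, ‖weilConv (moll (n + 1)) (weilReflect (moll (n + 1))) x‖ = 1 :=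
    fun n ↦ integral_norm_sqMoll (n + 1)
  have hW := WeilApproxIdentity.tendsto_weilFunctional huc hδ0 hδ1 hus hu1 hun
    (continuous_twoTent b) (hasCompactSupport_twoTent b) (integrable_weilMellin_twoTent_digamma hb)
  have h1 : Tendsto (fun n : ℕ ↦ (weilFunctional (weilConv (twoTent b)
      (weilConv (moll (n + 1)) (weilReflect (moll (n + 1)))))).re) atTop
      (𝓝 (weilFunctional (twoTent b)).re) :=
    (Complex.continuous_re.tendsto _).comp hW
  have h2 : (weilFunctional (twoTent b)).re = 2 * zetaScrew (2 * b) := by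
    rw [weilFunctional_twoTent hb]
    simp
  rw [h2] at h1
  exact h1.congr fun n ↦ by rw [weilQuadratic_smoothBox]

/-- `‖𝟙_b ⋆ φ_{n+1}‖₂² → 2b` (`b ≥ 0`). -/
theorem tendsto_integral_norm_sq_smoothBox {b : ℝ} (hb : 0 ≤ b) :
    Tendsto (fun n : ℕ ↦ ∫ x : ℝ, ‖smoothBox b (n + 1) x‖ ^ 2) atTop (𝓝 (2 * b)) := by
  have huc : ∀ n : ℕ, Continuous (weilConv (moll (n + 1)) (weilReflect (moll (n + 1)))) :=
    fun n ↦ continuous_sqMoll (n + 1)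
  have hδ0 : Tendsto (fun n : ℕ ↦ 2 * (bump (n + 1)).rOut) atTop (𝓝 0) :=
    tendsto_two_mul_bump_rOut.comp (tendsto_add_atTop_nat 1)
  have hus : ∀ (n : ℕ) (x : ℝ), 2 * (bump (n + 1)).rOut ≤ |x| →
      weilConv (moll (n + 1)) (weilReflect (moll (n + 1))) x = 0 := fun n x hx ↦ sqMoll_eq_zero hx
  have hu1 : ∀ n : ℕ, ∫ x, weilConv (moll (n + 1)) (weilReflect (moll (n + 1))) x = 1 :=
    fun n ↦ integral_sqMoll (n + 1)
  have hun : ∀ n : ℕ, ∫ x, ‖weilConv (moll (n + 1)) (weilReflect (moll (n + 1))) x‖ = 1 :=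
    fun n ↦ integral_norm_sqMoll (n + 1)
  have h0 := WeilApproxIdentity.tendsto_weilConv huc hδ0 hus hu1 hun (continuous_twoTent b) 0
  have h1 : Tendsto (fun n : ℕ ↦ (weilConv (twoTent b)
      (weilConv (moll (n + 1)) (weilReflect (moll (n + 1)))) 0).re) atTop (𝓝 (twoTent b 0).re) :=
    (Complex.continuous_re.tendsto _).comp h0
  rw [twoTent_zero hb, Complex.ofReal_re] at h1
  exact h1.congr fun n ↦ by rw [← integral_norm_sq_smoothBox, Complex.ofReal_re]

/-! ## The bound -/

/-- `ε(a) ≤ Ψ(2b)/b` for `0 < b < a` (the smoothed boxes `𝟙_b ⋆ φ_{n+1}` are eventually supported in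
`[-a, a]`, and their Rayleigh quotients tend to `Ψ(2b)/b`). -/
theorem weilGroundEnergy_le_zetaScrew_div_of_lt {a b : ℝ} (hb : 0 < b) (hba : b < a) :
    weilGroundEnergy a ≤ zetaScrew (2 * b) / b := by
  have hQ := tendsto_re_weilQuadratic_smoothBox hb.le
  have hN := tendsto_integral_norm_sq_smoothBox hb.le
  have hR : Tendsto (fun n : ℕ ↦ (weilQuadratic (smoothBox b (n + 1))).re /
      ∫ x : ℝ, ‖smoothBox b (n + 1) x‖ ^ 2) atTop (𝓝 (2 * zetaScrew (2 * b) / (2 * b))) :=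
    hQ.div hN (by positivity)
  have hlim : 2 * zetaScrew (2 * b) / (2 * b) = zetaScrew (2 * b) / b := by
    field_simp
  rw [← hlim]
  refine ge_of_tendsto hR ?_
  have hr : Tendsto (fun n : ℕ ↦ (bump (n + 1)).rOut) atTop (𝓝 0) :=
    tendsto_bump_rOut.comp (tendsto_add_atTop_nat 1)
  have hev1 : ∀ᶠ n : ℕ in atTop, (bump (n + 1)).rOut < a - b :=
    (tendsto_order.1 hr).2 (a - b) (by linarith)
  have hev2 : ∀ᶠ n : ℕ in atTop, b < ∫ x : ℝ, ‖smoothBox b (n + 1) x‖ ^ 2 :=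
    (tendsto_order.1 hN).1 b (by linarith)
  filter_upwards [hev1, hev2] with n h1 h2
  refine weilGroundEnergy_le_div (isWeilTest_smoothBox b (n + 1)) ?_ (hb.trans h2)
  exact (tsupport_smoothBox_subset b (n + 1)).trans (Icc_subset_Icc (by linarith) (by linarith))

/-- **The screw function bounds the window ground energy**: `ε(a) ≤ Ψ(2a)/a` for every `a > 0`
(let `b ↑ a` in `weilGroundEnergy_le_zetaScrew_div_of_lt`, `Ψ` being continuous). In Suzuki's
language (arXiv:2606.09096): the bottom `λ_a` of the spectrum of `A_a` lies below the Rayleigh quotient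
of Weil's form at the indicator of the window, which is `Ψ(2a)/a`. -/
theorem weilGroundEnergy_le_zetaScrew_div {a : ℝ} (ha : 0 < a) :
    weilGroundEnergy a ≤ zetaScrew (2 * a) / a := by
  have hc : ContinuousAt (fun b : ℝ ↦ zetaScrew (2 * b) / b) a :=
    ((continuous_zetaScrew.comp (continuous_const.mul continuous_id)).continuousAt).div
      continuousAt_id ha.ne'
  have ht : Tendsto (fun b : ℝ ↦ zetaScrew (2 * b) / b) (𝓝[<] a) (𝓝 (zetaScrew (2 * a) / a)) :=
    hc.tendsto.mono_left nhdsWithin_le_nhds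
  refine ge_of_tendsto ht ?_
  filter_upwards [Ioo_mem_nhdsLT ha] with b hb
  exact weilGroundEnergy_le_zetaScrew_div_of_lt hb.1 hb.2

/-- The same with `t = 2a`: `ε(t/2) ≤ 2Ψ(t)/t` (`t > 0`). -/
theorem weilGroundEnergy_half_le {t : ℝ} (ht : 0 < t) :
    weilGroundEnergy (t / 2) ≤ 2 * zetaScrew t / t := by
  have h := weilGroundEnergy_le_zetaScrew_div (a := t / 2) (by positivity)
  rw [mul_div_cancel₀ _ (two_ne_zero' ℝ)] at h
  calc weilGroundEnergy (t / 2) ≤ zetaScrew t / (t / 2) := h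
    _ = 2 * zetaScrew t / t := by field_simp

/-- **A negative screw value forces negative ground energy on the half window.** -/
theorem weilGroundEnergy_neg_of_zetaScrew_neg {t : ℝ} (ht : 0 < t) (hΨ : zetaScrew t < 0) :
    weilGroundEnergy (t / 2) < 0 :=
  (weilGroundEnergy_half_le ht).trans_lt (div_neg_of_neg_of_pos (by linarith) ht)

/-- **… hence Weil positivity fails on the window `[-t/2, t/2]`** (`weilGroundEnergy_nonneg_iff_holds`). -/
theorem not_weilPositivityOn_of_zetaScrew_neg {t : ℝ} (ht : 0 < t) (hΨ : zetaScrew t < 0) :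
    ¬ WeilPositivityOn (t / 2) := fun h ↦
  absurd ((weilGroundEnergy_nonneg_iff_holds (by positivity)).2 h)
    (not_le.2 (weilGroundEnergy_neg_of_zetaScrew_neg ht hΨ))

/-- Contrapositive: **Weil positivity on `[-a, a]` implies `Ψ ≥ 0` on `[0, 2a]`** (and on `[-2a, 2a]`
by evenness). -/
theorem zetaScrew_nonneg_of_weilPositivityOn {a : ℝ} (h : WeilPositivityOn a) {t : ℝ}
    (ht : |t| ≤ 2 * a) : 0 ≤ zetaScrew t := by
  rcases eq_or_ne t 0 with rfl | ht0
  · rw [zetaScrew_zero]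
  have htpos : 0 < |t| := abs_pos.2 ht0
  have hmono : WeilPositivityOn (|t| / 2) := fun g hg hsupp ↦
    h g hg (hsupp.trans (Icc_subset_Icc (by linarith) (by linarith)))
  by_contra hneg
  rw [not_le, ← zetaScrew_abs] at hneg
  exact not_weilPositivityOn_of_zetaScrew_neg htpos hneg hmono

end Summit.RiemannHypothesis.RiemannHypothesis.Theorems
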